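/-
Copyright (c) 2026. All rights reserved.
Released under Apache 2.0 license as described in the file LICENSE.
Authors: solo-Langlands-informed (ideation tier, family 6).
-/
import Literature.NumberTheory.PAdicHodge.DeRhamRankOneSemiInvariantVector
import Literature.NumberTheory.PAdicHodge.BdRFiniteImage
import Literature.NumberTheory.GaloisRepresentations.CharacterPeriodsOfAdmissible
import HarnessLib

/-!
# A de Rham character is `ℂ_F`-admissible up to a cyclotomic twist at EVERY embedding

`Proofs`-style file (theorems only).  Topic `NumberTheory/PAdicHodge`; namespace
`Literature.NumberTheory.PAdicHodge.DeRhamRankOne`.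

**What is printed.**  Fontaine (Astérisque 223, Exp. III §1.5 with Exp. II §1.5) and Conrad (2011,
App. B): for a de Rham character `ψ : Γ_F → E×` with coefficients in a finite `E/ℚ_p`, `D_dR(V)` of the
underlying `ℚ_p`-representation `V = E` is free of rank one over `F ⊗_{ℚ_p} E`, so EVERY `ℚ_p`-embedding
`j : E → F̄` carries a nonzero period `z_j ∈ B_dR(F)` of the `F̄`-valued character `j ∘ ψ` of the stabiliser
of `j`; writing `z_j = u^n w` (`B_dR⁺` a discrete valuation ring with uniformiser `u`, `σ u = k_σ u`,
`θ(k_σ) = χ(σ)`) and applying `θ` gives a nonzero `y_j = θ(w) ∈ ℂ_F` with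
`y_j = j(ψ σ) · χ(σ)^n · σ(y_j)` on the stabiliser: the character `(j∘ψ)·χ^n` is `ℂ_F`-admissible there —
the Hodge–Tate decomposition of `V ⊗ ℂ_F` read embedding by embedding (Serre 1968, III-A; Tate 1967 §3.3),
the input of Tate's theorem "Hodge–Tate characters are locally algebraic".

**What is proved here.**
* `exists_thetaBdR_period_of_fracBdR_period` — the rank-one `θ`-reduction: a nonzero `z ∈ B_dR(F)` with
  `z = ι(φ σ) · σ(z)` for `σ` in some set `Q ⊆ Γ_F` (`φ : Γ_F → F̄`, `ι : F̄ ↪ B_dR⁺ ⊆ B_dR` the section of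
  `θ`, tree `algClosureToBdR`) yields `n ∈ ℤ` and a nonzero `y ∈ ℂ_F` with
  `y = φ(σ) · χ(σ)^n · σ(y)` for `σ ∈ Q`.
* `exists_theta_period_of_isDeRham_bdR` — for `rE : Γ_F → GL₁(E)` with `restrictScalarsQl E rE`
  de Rham for `B_dR(F)` and every `j : E →ₐ[ℚ_p] F̄`: some `n ∈ ℤ` and `y ∈ ℂ_F ∖ 0` with
  `y = j(rE(σ)₀₀) · χ(σ)^n · σ(y)` whenever `σ ∘ j = j` (accepted
  `PeriodRingData.exists_stabilizerPeriod_of_isAdmissible` + the `θ`-reduction).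
* `exists_model_theta_periods_of_isDeRhamFramed` — the same from `(fontainePst F p hp).IsDeRhamFramed r` for
  `r : Γ_F → GL₁(ℚ̄_p)`: a finite `E ⊆ ℚ̄_p`, a model `rE` with `r(σ)₀₀ = rE(σ)₀₀`, and for every `j` such
  `n_j`, `y_j`.

## References
* [FontaineAsterisque223III] J.-M. Fontaine, Astérisque 223 (1994), Exp. II §1.5.4–1.5.5, Exp. III §1.5.
* [SerreAbelianLadic1968] J.-P. Serre, *Abelian ℓ-adic representations and elliptic curves* (1968), Ch. III, App. A.1, A.5.
* [Conrad2011LiftingGlobal] B. Conrad, *Lifting global representations with local properties* (2011), App. B.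
* [Tate1967] J. Tate, *p-divisible groups* (1967), §3.3.
-/

noncomputable section

open Field ValuativeRel Matrix WittVector
open scoped MatrixGroups

namespace Literature.NumberTheory.PAdicHodge

open Literature.NumberTheory.GaloisRepresentations
open Literature.NumberTheory.GaloisRepresentations.IsNonarchimedeanLocalField
open Literature.NumberTheory.Automorphic

namespace DeRhamRankOne

section Theta

variable {F : Type} [Field F] [ValuativeRel F] [TopologicalSpace F] [IsNonarchimedeanLocalField F]
  [CharZero F] {p : ℕ} [Fact p.Prime] [Fact (¬ IsUnit (p : integerC F))]
  [IsAdicComplete (Ideal.span {(p : integerC F)}) (integerC F)]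
  (hp : valuation F p < 1) (hF : Function.Surjective (fontaineTheta (integerC F) p))
  [IsDomain (BDeRhamPlus (integerC F) p)]

include hp in
/-- **`θ`-reduction of a rank-one period.**  Let `φ : Γ_F → F̄`, `Q ⊆ Γ_F`, and `z ∈ B_dR(F)`, `z ≠ 0`,
with `z = ι(φ σ) · σ(z)` for `σ ∈ Q` (`ι : F̄ ↪ B_dR⁺ ⊆ B_dR` the section of `θ`).  Then for some `n ∈ ℤ`
there is `y ∈ ℂ_F`, `y ≠ 0`, with `y = φ(σ) · χ(σ)^n · σ(y)` for all `σ ∈ Q` (`χ` the cyclotomic character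
through `ℤ_p ⊆ ℚ_p → F → ℂ_F`): write `z = u^n w` with `w ∈ (B_dR⁺)ˣ`, use `σ(u) = k_σ u`,
`θ(k_σ) = χ(σ)` and take `y = θ(w)`. [cite: FontaineAsterisque223III, Exp. II §1.5.4–1.5.5]
[cite: SerreAbelianLadic1968, Ch. III §A.1] -/
theorem exists_thetaBdR_period_of_fracBdR_period {Q : absoluteGaloisGroup F → Prop}
    {φ : absoluteGaloisGroup F → AlgebraicClosure F} {z : FracBdR F p} (hz0 : z ≠ 0)
    (hz : ∀ σ : absoluteGaloisGroup F, Q σ →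
      z = ((algebraMap (BDeRhamPlus (integerC F) p) (FracBdR F p)).comp (algClosureToBdR hp hF)) (φ σ) *
        σ • z) :
    ∃ (n : ℤ) (y : CompletedAlgClosure F), y ≠ 0 ∧ ∀ σ : absoluteGaloisGroup F, Q σ →
      y = algClosureToC F (φ σ) *
        (algebraMap F (CompletedAlgClosure F)
          (LocalField.padicRingHom F p hp
            (((GaloisRep.cyclotomicCharacter F p σ : ℤ_[p]ˣ) : ℤ_[p]) : ℚ_[p]))) ^ n * σ • y := by
  classical
  set a := algebraMap (BDeRhamPlus (integerC F) p) (FracBdR F p) with ha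
  have hu0 : a uBdR ≠ 0 := by
    obtain ⟨v, hv, huv⟩ := exists_uBdR_eq_xiBdR_mul (F := F) (p := p) hF
    rw [huv, map_mul]
    exact mul_ne_zero (algebraMap_xiBdR_ne_zero hF)
      ((map_ne_zero_iff _ algebraMap_fracBdR_injective).2 hv.ne_zero)
  obtain ⟨n, w, hw⟩ := exists_eq_uBdR_zpow_mul hF hz0
  refine ⟨n, thetaBdR (w : BDeRhamPlus (integerC F) p),
    (isUnit_iff_thetaBdR_ne_zero hF _).1 w.isUnit, fun σ hσ => ?_⟩
  -- `σ(u) = k_σ u`, `θ(k_σ) = χ(σ)`, `k_σ` a unit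
  obtain ⟨kσ, hkσ, hθk⟩ := exists_galBdRPlus_uBdR_eq_mul_cyclotomic hp hF σ
  have hkunit : IsUnit kσ := by
    rw [isUnit_iff_thetaBdR_ne_zero hF, hθk, map_ne_zero_iff _ (algebraMap F (CompletedAlgClosure F)).injective,
      map_ne_zero_iff _ (LocalField.padicRingHom F p hp).injective]
    exact PadicInt.coe_ne_zero.2 (GaloisRep.cyclotomicCharacter F p σ).ne_zero
  have hσu : σ • (a uBdR ^ n) = (a kσ * a uBdR) ^ n := by
    rw [smul_fracBdR_eq_toRingHom σ (_ ^ n), map_zpow₀, ← smul_fracBdR_eq_toRingHom, ha,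
      smul_algebraMap_fracBdR, hkσ, map_mul]
  -- the relation, in `B_dR`
  have h1 : a uBdR ^ n * a (w : BDeRhamPlus (integerC F) p) =
      a uBdR ^ n * (a (algClosureToBdR hp hF (φ σ)) * a kσ ^ n *
        a (galBdRPlus σ (w : BDeRhamPlus (integerC F) p))) := by
    have h := hz σ hσ
    rw [hw, smul_mul', hσu, ← ha, smul_algebraMap_fracBdR, RingHom.comp_apply, ← ha, mul_zpow] at h
    refine h.trans ?_
    ring
  have h1' : a (w : BDeRhamPlus (integerC F) p) =
      a (algClosureToBdR hp hF (φ σ)) * a kσ ^ n * a (galBdRPlus σ (w : BDeRhamPlus (integerC F) p)) :=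
    mul_left_cancel₀ (zpow_ne_zero n hu0) h1
  -- pulled back to `B_dR⁺`
  have h2 : (w : BDeRhamPlus (integerC F) p) =
      algClosureToBdR hp hF (φ σ) * ((hkunit.unit ^ n : (BDeRhamPlus (integerC F) p)ˣ) :
        BDeRhamPlus (integerC F) p) * galBdRPlus σ (w : BDeRhamPlus (integerC F) p) := by
    apply algebraMap_fracBdR_injective (F := F) (p := p)
    rw [← ha, h1', map_mul, map_mul, ringHom_units_zpow, IsUnit.unit_spec]
  -- apply `θ`
  have h3 := congrArg thetaBdR h2
  rw [map_mul, map_mul, ringHom_units_zpow, IsUnit.unit_spec, hθk, thetaBdR_galBdRPlus,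
    thetaBdR_algClosureToBdR] at h3
  exact h3

end Theta

section DeRham

variable {F : Type} [Field F] [ValuativeRel F] [TopologicalSpace F] [IsNonarchimedeanLocalField F]
  [CharZero F] {p : ℕ} [Fact p.Prime] (hp : valuation F p < 1)

-- Mathlib's own global value of `maxSynthPendingDepth` (as in `isAdmissible_bdR_of_unramified`).
set_option maxSynthPendingDepth 3 in
/-- **A `B_dR`-admissible character is `ℂ_F`-admissible up to a cyclotomic twist at every embedding.**
Let `rE : Γ_F → GL₁(E)`, `E/ℚ_p` finite inside `ℚ̄_p`, with `restrictScalarsQl E rE` de Rham for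
`bdRPeriodRingData`, and let `j : E → F̄` be a `ℚ_p`-embedding.  Then for some `n ∈ ℤ` there is
`y ∈ ℂ_F`, `y ≠ 0`, with `y = j(rE(σ)₀₀) · χ(σ)^n · σ(y)` for all `σ ∈ Γ_F` with `σ ∘ j = j`.
[cite: FontaineAsterisque223III, Exp. III §1.5, Prop. 1.5.2] [cite: Conrad2011LiftingGlobal, Appendix B]
[cite: SerreAbelianLadic1968, Ch. III §A.5] -/
theorem exists_theta_period_of_isDeRham_bdR [Algebra ℚ_[p] F]
    [Fact (¬ IsUnit ((p : ℕ) : integerC F))]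
    [IsAdicComplete (Ideal.span {((p : ℕ) : integerC F)}) (integerC F)]
    {E : IntermediateField ℚ_[p] (PadicAlgCl p)} [FiniteDimensional ℚ_[p] E]
    (rE : FramedRep (absoluteGaloisGroup F) E 1)
    (hdR : (restrictScalarsQl E rE).IsDeRham (bdRPeriodRingData (F := F) (p := p) hp))
    (j : E →ₐ[ℚ_[p]] AlgebraicClosure F) :
    ∃ (n : ℤ) (y : CompletedAlgClosure F), y ≠ 0 ∧ ∀ σ : absoluteGaloisGroup F, (∀ x : E, σ • j x = j x) →
      y = algClosureToC F (j ((((rE σ : GL (Fin 1) E)) : Matrix (Fin 1) (Fin 1) E) 0 0)) *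
        (algebraMap F (CompletedAlgClosure F)
          (LocalField.padicRingHom F p hp
            (((GaloisRep.cyclotomicCharacter F p σ : ℤ_[p]ˣ) : ℤ_[p]) : ℚ_[p]))) ^ n * σ • y := by
  classical
  have hF : Function.Surjective (fontaineTheta (integerC F) p) := surjective_fontaineTheta_integerC hp
  haveI : IsDomain (BDeRhamPlus (integerC F) p) := isDomain_bDeRhamPlus hF
  haveI : FiniteDimensional ℚ_[p] (Fin 1 → E) := inferInstance
  -- `restrictScalarsQl E rE σ` is multiplication by `rE(σ)₀₀`
  have hρ : ∀ (σ : absoluteGaloisGroup F) (c : E),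
      restrictScalarsQl E rE σ ((LinearEquiv.funUnique (Fin 1) ℚ_[p] E).symm c) =
        (LinearEquiv.funUnique (Fin 1) ℚ_[p] E).symm
          ((((rE σ : GL (Fin 1) E) : Matrix (Fin 1) (Fin 1) E) 0 0) * c) := by
    intro σ c
    funext i
    rw [restrictScalarsQl_apply_apply, FramedRep.toContinuousRep_apply_apply]
    simp only [LinearEquiv.funUnique, Matrix.mulVec, dotProduct, Fin.sum_univ_one, Subsingleton.elim i 0]
    rfl
  -- a `B_dR`-period at the embedding `j`
  obtain ⟨z, hz0, hz⟩ := PeriodRingData.exists_stabilizerPeriod_of_isAdmissible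
    (bdRPeriodRingData (F := F) (p := p) hp)
    ((algebraMap (BDeRhamPlus (integerC F) p) (FracBdR F p)).comp (algClosureToBdR hp hF))
    (fun σ x => smul_algClosureToFracBdR hp σ x) (fun a => algClosureToFracBdR_algebraMap hp a)
    (restrictScalarsQl E rE) (fun σ => (((rE σ : GL (Fin 1) E)) : Matrix (Fin 1) (Fin 1) E) 0 0)
    (LinearEquiv.funUnique (Fin 1) ℚ_[p] E).symm hρ hdR j
  exact exists_thetaBdR_period_of_fracBdR_period hp hF hz0 hz

/-- **The de Rham character of THE datum, embedding by embedding.**  For `r : Γ_F → GL₁(ℚ̄_p)` with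
`(fontainePst F p hp).IsDeRhamFramed r` there are a finite `E ⊆ ℚ̄_p` and a model `rE : Γ_F → GL₁(E)` with
`r(σ)₀₀ = rE(σ)₀₀`, such that for every `ℚ_p`-embedding `j : E → F̄` some `n ∈ ℤ` and `y ∈ ℂ_F ∖ 0`
satisfy `y = j(rE(σ)₀₀) · χ(σ)^n · σ(y)` whenever `σ ∘ j = j` — the character `(j ∘ ψ)·χ^n` of
`Stab(j)` is `ℂ_F`-admissible (the `ℚ_p`-structure of `F` is the canonical one).
[cite: FontaineAsterisque223III, Exp. III §1.5] [cite: SerreAbelianLadic1968, Ch. III §A.5] [cite: Tate1967, §3.3] -/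
theorem exists_model_theta_periods_of_isDeRhamFramed
    (r : FramedRep (absoluteGaloisGroup F) (PadicAlgCl p) 1) (hr : (fontainePst F p hp).IsDeRhamFramed r) :
    letI := LocalField.padicAlgebra F p hp
    ∃ (E : IntermediateField ℚ_[p] (PadicAlgCl p)) (_ : FiniteDimensional ℚ_[p] E)
      (rE : FramedRep (absoluteGaloisGroup F) E 1),
      (∀ σ, ((r σ : GL (Fin 1) (PadicAlgCl p)) : Matrix (Fin 1) (Fin 1) (PadicAlgCl p)) 0 0 =
        algebraMap E (PadicAlgCl p) ((((rE σ : GL (Fin 1) E)) : Matrix (Fin 1) (Fin 1) E) 0 0)) ∧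
      ∀ j : E →ₐ[ℚ_[p]] AlgebraicClosure F,
        ∃ (n : ℤ) (y : CompletedAlgClosure F), y ≠ 0 ∧
          ∀ σ : absoluteGaloisGroup F, (∀ x : E, σ • j x = j x) →
            y = algClosureToC F (j ((((rE σ : GL (Fin 1) E)) : Matrix (Fin 1) (Fin 1) E) 0 0)) *
              (algebraMap F (CompletedAlgClosure F)
                (LocalField.padicRingHom F p hp
                  (((GaloisRep.cyclotomicCharacter F p σ : ℤ_[p]ˣ) : ℤ_[p]) : ℚ_[p]))) ^ n * σ • y := by
  letI := LocalField.padicAlgebra F p hp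
  haveI : Fact (¬ IsUnit ((p : ℕ) : integerC F)) := ⟨not_isUnit_natCast_integerC hp⟩
  haveI : IsAdicComplete (Ideal.span {((p : ℕ) : integerC F)}) (integerC F) :=
    isAdicComplete_integerC_natCast hp
  obtain ⟨E, hE, rE, hmodel, hdR⟩ := exists_hasQlModel_isDeRham_bdR_of_fontainePst hp hr
  exact ⟨E, hE, rE, fun σ => apply_eq_algebraMap_of_hasQlModel hmodel σ, fun j =>
    exists_theta_period_of_isDeRham_bdR hp rE hdR j⟩

end DeRham

end DeRhamRankOne

end Literature.NumberTheory.PAdicHodge
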